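import Summits.ResolutionOfSingularities.ResolutionOfSingularities.Theorems.HomologicalConductorNoZenoE3PrimeDivisor
import Literature.AlgebraicGeometry.Resolution.CompositeValuations
import HarnessLib

/-!
# Crux `NoZenoR` (stmt-ResolutionOfSingularities-19943), slot 3 `stub_noCaZenoChainSharpF`, habitat `E3^{pd}`:
# THE FROZEN DIVISOR — the coarsening's local ring freezes, equals `O_E` under exhaustion, and the shadow set-up on `κ(E)`

OURS (cell res-hironaka, crux chain W4.4; lead res-L0-w44-lead-1 g10, DESK WORD 44/44a OBJECT 3-V «FROZEN DIVISOR»).  AI-written, weaker than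
expert review; nothing here is a statement of the manuscript under review (Hironaka 2017).  SUPPORT-level, counted 0.  Def-free, fact-free.
The load-bearing inclusions are the tree's coarsening-thread layer (`Coarsening.unitCreating_of_noThread`, `unit_persists`,
`chart_le_loc_of_unit`, `tower_le_loc_of_unit`; ideator res-L0-w44-idea-1 card 8, port p-CoarseningThread); this file packages the EQUALITIES.

SETTING: the kernel datum with `PersistenceRadical`, `StrictDrop`, the maximality binder `hmax`, threadlessness, a proper coarsening
`O < O₁` (NO transcendence-degree clause, NO exhaustion until §3).

* §1 `exists_unitStage` — CT: some stage `n₁ + 1 ≥ 1` carries a non-zero `O₁`-unit in its cohomology annihilator, and then EVERY later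
  stage does (`exists_unit_mem_ca_of_le`: the shadow conductors `J_M := (ca(T_M) + 𝔮_M)/𝔮_M` are non-zero); every late ADMISSIBLE
  DENOMINATOR (a minimal-`O`-value element of `ca(T_M)`) is an `O₁`-UNIT (`admissible_inv_mem_coarsening`: StrictDrop runs in the socle).
* §2 FREEZING `loc_coarsening_frozen` — `loc O₁ (T_M) = loc O₁ (T_(n₁+1))` for all `M ≥ n₁ + 1`: the local ring of the coarsening's
  centre FREEZES at a regular essentially-finite-type local ring `L(O₁)` containing all later stages (any tr.deg, no exhaustion — bears on the
  frontier half `H` too).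
* §3 WITH EXHAUSTION `loc_coarsening_eq_of_exhausts` — `(loc O₁ (T_M)).toSubring = O₁.toSubring` for all late `M`: the coarsening IS the local
  ring of its centre on every late stage (`E = V(𝔮_M)` is a divisor ON the stages when `O₁ = O_E` is a prime divisor, habitat `E3^{pd}`), and
  the SHADOW exhausts: every element of the residual valuation ring `Ō = residueValuationSubring O O₁` of `κ(O₁)` is the residue of a stage
  element (`shadow_exhausts`).
* §4 TEXT `noCaZenoChainSharp3_of_frozenDivisor : <E3^{E}> → <E3^{pd}>` — `E3^{E}` = `E3^{pd}` with the prime-divisor clause strengthened by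
  the frozen-divisor clause «`∃ m, ∀ M ≥ m, (loc O₁ (tower O A M)).toSubring = O₁.toSubring`».  Residual of record for slot 3: {H, E3^{E}}.

References: OURS (idea-1 card 8 `coarsening-thread`; tree `…NoZenoCoarseningThread`); J. Novacoski, M. Spivakovsky (2014) §2.1 (composite
valuations; tree `residueValuationSubring`).
-/

noncomputable section

-- single-problem summit: the doubled namespace component `ResolutionOfSingularities` is forced
set_option linter.dupNamespace false

namespace Summit.ResolutionOfSingularities.ResolutionOfSingularities.Theorems.NoZeno.CompositeSplit

open Summit.ResolutionOfSingularities.ResolutionOfSingularities.Theses.HomologicalConductor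
open Summit.ResolutionOfSingularities.ResolutionOfSingularities.Theorems.NoZeno.Birth
open Summit.ResolutionOfSingularities.ResolutionOfSingularities.Theorems.NoZeno.SandwichCluster.Parasite
open Summit.ResolutionOfSingularities.ResolutionOfSingularities.Theorems
open Summit.ResolutionOfSingularities.ResolutionOfSingularities.Theorems.NoZeno
open Literature.AlgebraicGeometry.Resolution
open IsLocalRing Polynomial

variable {k K : Type} [Field k] [Field K] [Algebra k K]

/-! ## §1 The unit stage and the late conductors -/

/-- **THE UNIT STAGE (CT, packaged).**  For a threadless kernel tower with radical persistence and StrictDrop and a proper coarsening `O < O₁`: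
some stage `n₁ + 1` carries a non-zero `O₁`-unit in `ca(T_(n₁+1))` (if `T_0` is already regular we take `n₁ = 0`: then `ca(T_1) = T_1 ∋ 1`).
[this work; OURS: `Coarsening.unitCreating_of_noThread`] -/
theorem exists_unitStage (hP : PersistenceRadical) (hD : StrictDrop) (p : ℕ) (hp : p.Prime)
    (k K : Type) [Field k] [CharP k p] [Field K] [Algebra k K] (O : ValuationSubring K) (A : Subalgebra k K)
    (hk : ∀ c : k, algebraMap k K c ∈ O) (hA : A.FG) (hfr : IsFractionRing ↥A K) (hAO : A.toSubring ≤ O.toSubring)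
    (hmax : ∀ O' : ValuationSubring K, O < O' → ∃ m : ℕ, ∃ s ∈ tower O A m, s⁻¹ ∈ O' ∧ s⁻¹ ∉ O)
    (hthr : ¬ SingularPrimeThread O A) (O₁ : ValuationSubring K) (hOO₁ : O < O₁) :
    ∃ n₁ : ℕ, ∃ c ∈ ca (tower O A (n₁ + 1)), c ≠ 0 ∧ c⁻¹ ∈ O₁ := by
  classical
  have hPR : ∀ m : ℕ, ∀ x ∈ ca (tower O A m), ∃ N : ℕ, 1 ≤ N ∧ x ^ N ∈ ca (tower O A (m + 1)) :=
    hP p hp k K O A hk hA hfr hAO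
  by_cases h0 : IsRegularLocalRing ↥(tower O A 0)
  · -- the tower is stationary and `1 ∈ ca(T_1)`
    refine ⟨0, 1, ?_, one_ne_zero, by rw [inv_one]; exact O₁.one_mem⟩
    have h1 : IsRegularLocalRing ↥(tower O A 1) := by
      rw [NoetherianCapture.tower_eq_of_le_of_isRegularLocalRing O A hk hfr hAO 0 h0 1 (Nat.zero_le 1)]; exact h0
    -- `1 ∈ ca(T_1)` (Iyengar–Takahashi: `ca = ⊤` for a regular local ring; tree `cohomologyAnnihilator_eq_top_iff_isRegularLocalRing`)
    have htop := (Literature.RingTheory.CohomologyAnnihilator.cohomologyAnnihilator_eq_top_iff_isRegularLocalRing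
      (R := ↥(tower O A 1))).mpr h1
    have h1' : ((1 : ↥(tower O A 1)) : K) ∈ ca (tower O A 1) := (tn_coe_mem_ca_iff _ 1).mpr (by rw [htop]; trivial)
    simpa using h1'
  have hdrop : ∀ m : ℕ, ¬ IsRegularLocalRing ↥(tower O A m) → ∃ m' : ℕ, m < m' ∧
      ∃ y ∈ ca (tower O A m'), y ≠ 0 ∧ ∀ x ∈ ca (tower O A m), x ≠ 0 → y * x⁻¹ ∉ O :=
    hD p hp k K O A hk hA hfr hAO
  have hne : ∃ m, ∃ x ∈ ca (tower O A m), x ≠ 0 := by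
    obtain ⟨m', -, y, hy, hy0, -⟩ := hdrop 0 h0
    exact ⟨m', y, hy, hy0⟩
  obtain ⟨M, hcM⟩ := Coarsening.unitCreating_of_noThread O A hk hA hfr hAO hPR hne hthr O₁ (hmax O₁ hOO₁)
  exact ⟨M, Coarsening.unit_persists O A hPR O₁ hcM (Nat.le_succ M)⟩

/-- **Late conductors hold `O₁`-units** (the shadow conductors are non-zero): from the unit stage on, every `ca(T_M)` contains a non-zero
`O₁`-unit. [this work; `Coarsening.unit_persists`] -/
theorem exists_unit_mem_ca_of_le (hP : PersistenceRadical) (p : ℕ) (hp : p.Prime)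
    (k K : Type) [Field k] [CharP k p] [Field K] [Algebra k K] (O : ValuationSubring K) (A : Subalgebra k K)
    (hk : ∀ c : k, algebraMap k K c ∈ O) (hA : A.FG) (hfr : IsFractionRing ↥A K) (hAO : A.toSubring ≤ O.toSubring)
    (O₁ : ValuationSubring K) {m₁ : ℕ} (hc : ∃ c ∈ ca (tower O A m₁), c ≠ 0 ∧ c⁻¹ ∈ O₁) {M : ℕ} (hM : m₁ ≤ M) :
    ∃ c ∈ ca (tower O A M), c ≠ 0 ∧ c⁻¹ ∈ O₁ :=
  Coarsening.unit_persists O A (hP p hp k K O A hk hA hfr hAO) O₁ hc hM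

/-- **ADMISSIBLE DENOMINATORS ARE `O₁`-UNITS.**  If `ca(T)` holds a non-zero `O₁`-unit `c₁` (`O ≤ O₁`), every admissible denominator `x` of the
`O`-chart of `T` — `x ∈ ca(T)` with `c' · x⁻¹ ∈ O` for all `c' ∈ ca(T)` (minimal `O`-value) — has `x⁻¹ ∈ O₁`: the conductor minima are
`O₁`-units, StrictDrop runs in the socle `Γ_{O/𝔪_{O₁}}`. [this work; the inequality inside `Coarsening.chart_le_loc_of_unit`] -/
theorem admissible_inv_mem_coarsening (O O₁ : ValuationSubring K) (hO : O ≤ O₁) (T : Subalgebra k K)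
    (hc : ∃ c₁ ∈ ca T, c₁ ≠ 0 ∧ c₁⁻¹ ∈ O₁) {x : K} (hmin : ∀ c' ∈ ca T, c' * x⁻¹ ∈ O) : x⁻¹ ∈ O₁ := by
  obtain ⟨c₁, hc₁, hc₁0, hc₁i⟩ := hc
  have h2 : x⁻¹ = c₁⁻¹ * (c₁ * x⁻¹) := by rw [← mul_assoc, inv_mul_cancel₀ hc₁0, one_mul]
  rw [h2]
  exact mul_mem hc₁i (hO (hmin c₁ hc₁))

/-! ## §2 Freezing -/

/-- **FREEZING.**  From the unit stage `n₁ + 1` on, the local ring of the coarsening's centre is CONSTANT: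
`loc O₁ (T_M) = loc O₁ (T_(n₁+1))` for all `M ≥ n₁ + 1` (⊆: the tail lives in the hull, `Coarsening.tower_le_loc_of_unit`, and `loc O₁` is
idempotent; ⊇: monotonicity).  No transcendence-degree clause, no exhaustion. [this work] -/
theorem loc_coarsening_frozen (hP : PersistenceRadical) (p : ℕ) (hp : p.Prime)
    (k K : Type) [Field k] [CharP k p] [Field K] [Algebra k K] (O : ValuationSubring K) (A : Subalgebra k K)
    (hk : ∀ c : k, algebraMap k K c ∈ O) (hA : A.FG) (hfr : IsFractionRing ↥A K) (hAO : A.toSubring ≤ O.toSubring)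
    (O₁ : ValuationSubring K) (hO : O ≤ O₁) {n₁ : ℕ} (hc : ∃ c ∈ ca (tower O A (n₁ + 1)), c ≠ 0 ∧ c⁻¹ ∈ O₁)
    {M : ℕ} (hM : n₁ + 1 ≤ M) : loc O₁ (tower O A M) = loc O₁ (tower O A (n₁ + 1)) := by
  have hPR : ∀ m : ℕ, ∀ x ∈ ca (tower O A m), ∃ N : ℕ, 1 ≤ N ∧ x ^ N ∈ ca (tower O A (m + 1)) :=
    hP p hp k K O A hk hA hfr hAO
  have hT₁O₁ : (tower O A (n₁ + 1)).toSubring ≤ O₁.toSubring := fun x hx => hO (TraceSocle.stage_le O A hk hAO _ x hx)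
  refine le_antisymm ?_ ?_
  · have h := Coarsening.tower_le_loc_of_unit O A hk hA hfr hAO hPR O₁ hO hc hM
    rw [loc_eq_locAt] at h
    rw [loc_eq_locAt, loc_eq_locAt]
    calc SyzygyFlattening.locAt O₁ (tower O A M)
        ≤ SyzygyFlattening.locAt O₁ (SyzygyFlattening.locAt O₁ (tower O A (n₁ + 1))) := SyzygyFlattening.locAt_mono O₁ h
      _ = SyzygyFlattening.locAt O₁ (tower O A (n₁ + 1)) := SyzygyFlattening.locAt_locAt O₁ _ hT₁O₁
  · rw [loc_eq_locAt, loc_eq_locAt]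
    exact SyzygyFlattening.locAt_mono O₁ fun x hx => d2rc_mem_tower_of_le O A hM hx

/-- **The frozen hull contains every stage** (late stages by `tower_le_loc_of_unit`, early ones by monotonicity). [this work] -/
theorem tower_le_frozenHull (hP : PersistenceRadical) (p : ℕ) (hp : p.Prime)
    (k K : Type) [Field k] [CharP k p] [Field K] [Algebra k K] (O : ValuationSubring K) (A : Subalgebra k K)
    (hk : ∀ c : k, algebraMap k K c ∈ O) (hA : A.FG) (hfr : IsFractionRing ↥A K) (hAO : A.toSubring ≤ O.toSubring)
    (O₁ : ValuationSubring K) (hO : O ≤ O₁) {n₁ : ℕ} (hc : ∃ c ∈ ca (tower O A (n₁ + 1)), c ≠ 0 ∧ c⁻¹ ∈ O₁)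
    (M : ℕ) : tower O A M ≤ loc O₁ (tower O A (n₁ + 1)) := by
  rcases le_or_gt (n₁ + 1) M with hM | hM
  · exact Coarsening.tower_le_loc_of_unit O A hk hA hfr hAO (hP p hp k K O A hk hA hfr hAO) O₁ hO hc hM
  · intro x hx
    rw [loc_eq_locAt]
    exact SyzygyFlattening.self_le_locAt O₁ _ (d2rc_mem_tower_of_le O A hM.le hx)

/-! ## §3 With exhaustion: the coarsening is the local ring of its centre; the shadow exhausts -/

/-- **A coarsening is the localisation of `O` at its centre**: for `O ≤ O₁`, every `x ∈ O₁` is `a · s⁻¹` with `a, s ∈ O` and `s` an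
`O₁`-unit (`s⁻¹ ∈ O₁`; indeed `s⁻¹ ∈ O` or `s = x⁻¹`). [folklore] -/
theorem exists_fraction_of_mem_coarsening (O O₁ : ValuationSubring K) (hO : O ≤ O₁) {x : K} (hx : x ∈ O₁) :
    ∃ a ∈ O, ∃ s ∈ O, s⁻¹ ∈ O₁ ∧ O₁.valuation s = 1 ∧ x = a * s⁻¹ := by
  by_cases hxO : x ∈ O
  · exact ⟨x, hxO, 1, O.one_mem, by rw [inv_one]; exact O₁.one_mem, by rw [map_one], by rw [inv_one, mul_one]⟩
  · have hx0 : x ≠ 0 := fun h => hxO (h ▸ O.zero_mem)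
    have hxi : x⁻¹ ∈ O := (O.mem_or_inv_mem x).resolve_left hxO
    refine ⟨1, O.one_mem, x⁻¹, hxi, by rw [inv_inv]; exact hx, ?_, by rw [inv_inv, one_mul]⟩
    exact SyzygyFlattening.valuation_eq_one_of_inv_mem O₁ (hO hxi) (by rw [inv_inv]; exact hx) (inv_ne_zero hx0)

/-- **UNDER EXHAUSTION THE FROZEN HULL IS THE COARSENING**: if the tower exhausts `O` and `ca(T_(n₁+1))` holds an `O₁`-unit, then
`(loc O₁ (T_M)).toSubring = O₁.toSubring` for every `M ≥ n₁ + 1` — the coarsening `O₁` is the local ring of its own centre on every late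
stage (for a prime divisor `O₁ = O_E`: `E` is a divisor ON the stages). [this work] -/
theorem loc_coarsening_eq_of_exhausts (hP : PersistenceRadical) (p : ℕ) (hp : p.Prime)
    (k K : Type) [Field k] [CharP k p] [Field K] [Algebra k K] (O : ValuationSubring K) (A : Subalgebra k K)
    (hk : ∀ c : k, algebraMap k K c ∈ O) (hA : A.FG) (hfr : IsFractionRing ↥A K) (hAO : A.toSubring ≤ O.toSubring)
    (O₁ : ValuationSubring K) (hO : O ≤ O₁) {n₁ : ℕ} (hc : ∃ c ∈ ca (tower O A (n₁ + 1)), c ≠ 0 ∧ c⁻¹ ∈ O₁)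
    (hexh : ∀ x : K, x ∈ O → ∃ m : ℕ, x ∈ tower O A m) {M : ℕ} (hM : n₁ + 1 ≤ M) :
    (loc O₁ (tower O A M)).toSubring = O₁.toSubring := by
  have hTO₁ : ∀ m, (tower O A m).toSubring ≤ O₁.toSubring := fun m x hx => hO (TraceSocle.stage_le O A hk hAO m x hx)
  refine le_antisymm ?_ fun x hx => ?_
  · rw [loc_eq_locAt]; exact SyzygyFlattening.locAt_le O₁ _ (hTO₁ M)
  · -- `x = a s⁻¹`, `a, s ∈ O ⊆ ⋃ T_m`, `s` an `O₁`-unit: `x ∈ loc O₁ (T_m) ⊆ frozen hull = loc O₁ (T_M)`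
    obtain ⟨a, haO, s, hsO, hsi, -, rfl⟩ := exists_fraction_of_mem_coarsening O O₁ hO hx
    obtain ⟨ma, ha⟩ := hexh a haO
    obtain ⟨ms, hs⟩ := hexh s hsO
    have ha' : a ∈ tower O A (max (max ma ms) (n₁ + 1)) := d2rc_mem_tower_of_le O A ((le_max_left _ _).trans (le_max_left _ _)) ha
    have hs' : s ∈ tower O A (max (max ma ms) (n₁ + 1)) := d2rc_mem_tower_of_le O A ((le_max_right _ _).trans (le_max_left _ _)) hs
    have hmem : a * s⁻¹ ∈ loc O₁ (tower O A (max (max ma ms) (n₁ + 1))) := by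
      rw [loc_eq_locAt]; exact SyzygyFlattening.mul_inv_mem_locAt O₁ _ ha' hs' hsi
    rw [loc_coarsening_frozen hP p hp k K O A hk hA hfr hAO O₁ hO hc (le_max_right _ _)] at hmem
    rw [Subalgebra.mem_toSubring, loc_coarsening_frozen hP p hp k K O A hk hA hfr hAO O₁ hO hc hM]
    exact hmem

/-- **THE SHADOW EXHAUSTS** the residual valuation ring: under exhaustion, every element of `Ō = residueValuationSubring O O₁` (the image of `O`
in `κ(O₁)`) is the residue of a STAGE element. [this work] -/
theorem shadow_exhausts (O O₁ : ValuationSubring K) (hO : O ≤ O₁) (A : Subalgebra k K)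
    (hexh : ∀ x : K, x ∈ O → ∃ m : ℕ, x ∈ tower O A m) (yb : ResidueField ↥O₁)
    (hyb : yb ∈ residueValuationSubring O O₁ hO) :
    ∃ (m : ℕ) (y : K) (_ : y ∈ tower O A m) (hyO : y ∈ O), residue ↥O₁ ⟨y, hO hyO⟩ = yb := by
  obtain ⟨a, ha⟩ := (mem_residueValuationSubring_iff O O₁ hO yb).mp hyb
  obtain ⟨m, hm⟩ := hexh a a.2
  exact ⟨m, a, hm, a.2, ha⟩

/-- **Residues detect the socle order**: for `O₁`-units `x, y ∈ O`, `y · x⁻¹ ∈ O` iff the residues satisfy `ȳ · x̄⁻¹ ∈ Ō`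
(tree `residue_mem_residueValuationSubring_iff`, `residue_mk_inv`). [folklore] -/
theorem mul_inv_mem_iff_residue (O O₁ : ValuationSubring K) (hO : O ≤ O₁) {x y : K} (hx : x ∈ O) (hy : y ∈ O)
    (hxi : x⁻¹ ∈ O₁) (hx0 : x ≠ 0) :
    y * x⁻¹ ∈ O ↔ residue ↥O₁ ⟨y, hO hy⟩ * (residue ↥O₁ ⟨x, hO hx⟩)⁻¹ ∈ residueValuationSubring O O₁ hO := by
  have hmem : y * x⁻¹ ∈ O₁ := O₁.mul_mem _ _ (hO hy) hxi
  have e : residue ↥O₁ ⟨y, hO hy⟩ * (residue ↥O₁ ⟨x, hO hx⟩)⁻¹ = residue ↥O₁ ⟨y * x⁻¹, hmem⟩ := by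
    rw [← residue_mk_inv O₁ (hO hx) hxi hx0, ← map_mul]; rfl
  rw [e, residue_mem_residueValuationSubring_iff]


/-! ## §4 TEXT LEVEL: `E3^{pd}` from the frozen-divisor habitat `E3^{E}` -/

/-- **`E3^{pd}` FROM `E3^{E}`.**  `h` = E3^{E} := the text `E3^{pd}` of `…NoZenoE3PrimeDivisor` (`noCaZenoChainSharp3_of_primeDivisorSplit`'s
hypothesis) with the prime-divisor clause STRENGTHENED by the frozen-divisor clause «`∃ m, ∀ M ≥ m, (loc O₁ (tower O A M)).toSubring =
O₁.toSubring`» (every proper coarsening is a prime divisor `E` which IS the local ring of its centre on every late stage); the conclusion is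
`E3^{pd}` verbatim.  The extra clause is free: `exists_unitStage` + `loc_coarsening_eq_of_exhausts`.  Residual of record for slot 3: {H, E3^{E}}.
[this work] -/
theorem noCaZenoChainSharp3_of_frozenDivisor
    (h :
      PersistenceRadical → StrictDrop → ∀ p : ℕ, p.Prime → ∀ (k K : Type) [Field k] [CharP k p] [Field K]
        [Algebra k K] (O : ValuationSubring K) (A : Subalgebra k K) (hk : ∀ c : k, algebraMap k K c ∈ O),
        A.FG → IsFractionRing ↥A K → A.toSubring ≤ O.toSubring →
        (∀ O' : ValuationSubring K,
          (∀ m : ℕ, ∀ s ∈ tower O A m, s ∈ O' ∧ (s⁻¹ ∈ O' → s⁻¹ ∈ O)) → ¬ IsNoetherianRing ↥O') →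
        (∀ O' : ValuationSubring K, O < O' → ∃ m : ℕ, ∃ s ∈ tower O A m, s⁻¹ ∈ O' ∧ s⁻¹ ∉ O) →
        (∀ (k' K' : Type) [Field k'] [CharP k' p] [Field K'] [Algebra k' K'] (O' : ValuationSubring K')
          (A' : Subalgebra k' K'), (∀ c : k', algebraMap k' K' c ∈ O') → A'.FG → IsFractionRing ↥A' K' →
          A'.toSubring ≤ O'.toSubring → Algebra.trdeg k' K' < Algebra.trdeg k K →
          ∃ m : ℕ, IsRegularLocalRing ↥(tower O' A' m)) →
        (∀ m : ℕ, ∀ s ∈ tower O A m, ∃ f : Polynomial k, f ≠ 0 ∧ O.valuation (Polynomial.aeval s f) < 1) →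
        Algebra.trdeg k K = 3 →
        (∃ O₁ : ValuationSubring K, O < O₁ ∧ O₁ ≠ ⊤) →
        (∀ U : ValuationSubring K, O < U → ∃ z : ℕ → K, (∀ n : ℕ, z n ∈ O ∧ z n ≠ 0 ∧ (z n)⁻¹ ∈ U) ∧
          (∀ n : ℕ, z n * (z (n + 1))⁻¹ ∈ O) ∧ ∀ n : ℕ, z (n + 1) * (z n)⁻¹ ∉ O) →
        (∀ (O₁ : ValuationSubring K) (h₁ : O < O₁), O₁ ≠ ⊤ →
          IsDiscreteValuationRing ↥O₁ ∧ residueTrdeg k O₁ (fun c => h₁.le (hk c)) = 2 ∧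
          ∃ m : ℕ, ∀ M : ℕ, m ≤ M → (loc O₁ (tower O A M)).toSubring = O₁.toSubring) →
        (∀ x : K, x ∈ O → ∃ m : ℕ, x ∈ tower O A m) →
        ¬ SingularPrimeThread O A →
        ∃ O₁ : ValuationSubring K, O < O₁ ∧ O₁ ≠ ⊤ ∧ ∃ m₀ : ℕ, ¬ ∃ z : ℕ → K,
          (∀ n : ℕ, (∃ m : ℕ, m₀ ≤ m ∧ z n ∈ ca (tower O A m)) ∧ z n ≠ 0 ∧ (z n)⁻¹ ∈ O₁) ∧
          (∀ n : ℕ, z n * (z (n + 1))⁻¹ ∈ O) ∧ ∀ n : ℕ, z (n + 1) * (z n)⁻¹ ∉ O) :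
    PersistenceRadical → StrictDrop → ∀ p : ℕ, p.Prime → ∀ (k K : Type) [Field k] [CharP k p] [Field K]
      [Algebra k K] (O : ValuationSubring K) (A : Subalgebra k K) (hk : ∀ c : k, algebraMap k K c ∈ O),
      A.FG → IsFractionRing ↥A K → A.toSubring ≤ O.toSubring →
      (∀ O' : ValuationSubring K,
        (∀ m : ℕ, ∀ s ∈ tower O A m, s ∈ O' ∧ (s⁻¹ ∈ O' → s⁻¹ ∈ O)) → ¬ IsNoetherianRing ↥O') →
      (∀ O' : ValuationSubring K, O < O' → ∃ m : ℕ, ∃ s ∈ tower O A m, s⁻¹ ∈ O' ∧ s⁻¹ ∉ O) →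
      (∀ (k' K' : Type) [Field k'] [CharP k' p] [Field K'] [Algebra k' K'] (O' : ValuationSubring K')
        (A' : Subalgebra k' K'), (∀ c : k', algebraMap k' K' c ∈ O') → A'.FG → IsFractionRing ↥A' K' →
        A'.toSubring ≤ O'.toSubring → Algebra.trdeg k' K' < Algebra.trdeg k K →
        ∃ m : ℕ, IsRegularLocalRing ↥(tower O' A' m)) →
      (∀ m : ℕ, ∀ s ∈ tower O A m, ∃ f : Polynomial k, f ≠ 0 ∧ O.valuation (Polynomial.aeval s f) < 1) →
      Algebra.trdeg k K = 3 →
      (∃ O₁ : ValuationSubring K, O < O₁ ∧ O₁ ≠ ⊤) →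
      (∀ U : ValuationSubring K, O < U → ∃ z : ℕ → K, (∀ n : ℕ, z n ∈ O ∧ z n ≠ 0 ∧ (z n)⁻¹ ∈ U) ∧
        (∀ n : ℕ, z n * (z (n + 1))⁻¹ ∈ O) ∧ ∀ n : ℕ, z (n + 1) * (z n)⁻¹ ∉ O) →
      (∀ (O₁ : ValuationSubring K) (h₁ : O < O₁), O₁ ≠ ⊤ →
        IsDiscreteValuationRing ↥O₁ ∧ residueTrdeg k O₁ (fun c => h₁.le (hk c)) = 2) →
      (∀ x : K, x ∈ O → ∃ m : ℕ, x ∈ tower O A m) →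
      ¬ SingularPrimeThread O A →
      ∃ O₁ : ValuationSubring K, O < O₁ ∧ O₁ ≠ ⊤ ∧ ∃ m₀ : ℕ, ¬ ∃ z : ℕ → K,
        (∀ n : ℕ, (∃ m : ℕ, m₀ ≤ m ∧ z n ∈ ca (tower O A m)) ∧ z n ≠ 0 ∧ (z n)⁻¹ ∈ O₁) ∧
        (∀ n : ℕ, z n * (z (n + 1))⁻¹ ∈ O) ∧ ∀ n : ℕ, z (n + 1) * (z n)⁻¹ ∉ O := by
  intro hP hD p hp k K _ _ _ _ O A hk hA hfr hAO hker hmax IH hzd htr hO₁ hnd hpd hexh hthr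
  have hpdE : ∀ (O₁ : ValuationSubring K) (h₁ : O < O₁), O₁ ≠ ⊤ →
      IsDiscreteValuationRing ↥O₁ ∧ residueTrdeg k O₁ (fun c => h₁.le (hk c)) = 2 ∧
      ∃ m : ℕ, ∀ M : ℕ, m ≤ M → (loc O₁ (tower O A M)).toSubring = O₁.toSubring := by
    intro O₁ h₁ htop
    obtain ⟨n₁, hc⟩ := exists_unitStage hP hD p hp k K O A hk hA hfr hAO hmax hthr O₁ h₁
    exact ⟨(hpd O₁ h₁ htop).1, (hpd O₁ h₁ htop).2, n₁ + 1, fun M hM =>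
      loc_coarsening_eq_of_exhausts hP p hp k K O A hk hA hfr hAO O₁ h₁.le hc hexh hM⟩
  exact h hP hD p hp k K O A hk hA hfr hAO hker hmax IH hzd htr hO₁ hnd hpdE hexh hthr

end Summit.ResolutionOfSingularities.ResolutionOfSingularities.Theorems.NoZeno.CompositeSplit

end
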